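import Summits.BirchSwinnertonDyer.BirchSwinnertonDyer.Theses.BiquadraticEisensteinDescent

/-!
# Sketch — crux-ideate seat 2, g25: first lemmas for card `linnik-sieve-residual-census`

BSD is not proved by this; `stmt-BirchSwinnertonDyer-21381` (`HeegnerTwistCouplingInSupply`) is NOT closed;
nothing here is prover work.  Corner layer only: the located-prime residual classes of the cell/ladder theorems
are polylog-sparse by Linnik's 1941 large sieve with a progression-restricted smooth amplifier.
-/

open scoped Classical

namespace Summit.BirchSwinnertonDyer.BirchSwinnertonDyer.Cruxes.HeegnerTwistCouplingInSupply.LinnikSieveResidualCensus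

/-- No located prime for the pin-free `j = 8000`, `p ≡ 5 (mod 8)` rung
(`…SqrtTwoLawConverse.cruxOnBpCornerPrimeTwist_of_two_facts`) up to height `y`:
every prime `ℓ ≤ y` with `ℓ ≡ 7 (mod 16)` has `(p/ℓ) ≠ +1`. -/
def NoLocatedPrime (p y : ℕ) : Prop :=
  ∀ ℓ : ℕ, ℓ.Prime → ℓ % 16 = 7 → ℓ ≤ y → jacobiSym (p : ℤ) ℓ ≠ 1

/-- The exceptional set of that rung up to `Q` at height `y` (primes `p ≡ 5 (mod 8)`, `y < p ≤ Q`, no located prime). -/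
noncomputable def exceptionalSet (Q y : ℕ) : Finset ℕ :=
  (Finset.range (Q + 1)).filter (fun p => p.Prime ∧ p % 8 = 5 ∧ y < p ∧ NoLocatedPrime p y)

/-- FIRST LEMMA (Linnik 1941 large sieve + amplifier supported on products of four located-class primes `≤ √Q`):
the located-prime residual is polylog-sparse.  Informal proof: on an exceptional `p` the Legendre symbol of every
`n = q₁q₂q₃q₄ ≤ Q²` (`qᵢ ≤ √Q`, `qᵢ ≡ 7 (16)`) equals `(-1)^4 = 1`, so `∑ₙ aₙ (n/p) = ‖a‖₁` with `a = 𝟙`; the large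
sieve over prime moduli `p ≤ Q` gives `#exc · S² ≤ (Q² + 4πQ²)·S`, `S ≍ Q²/log⁴Q`. -/
def ResidualCensus : Prop :=
  ∃ C : ℝ, 0 < C ∧ ∀ Q : ℕ, 3 ≤ Q → ((exceptionalSet Q (Nat.sqrt Q)).card : ℝ) ≤ C * Real.log Q ^ 4

/-- The analytic input as it would be cited (multiplicative large sieve restricted to prime moduli and Legendre
symbols; Montgomery 1971, Iwaniec–Kowalski Thm 7.13, Cojocaru–Murty §8 `(z² + 4πx)`), real weights on `[1, N]`. -/
def LargeSievePrimeModuli : Prop :=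
  ∀ (N Q : ℕ) (a : ℕ → ℝ),
    (∑ p ∈ (Finset.range (Q + 1)).filter (fun p => p.Prime ∧ Odd p),
        (∑ n ∈ Finset.Icc 1 N, a n * (jacobiSym (n : ℤ) p : ℝ)) ^ 2)
      ≤ ((Q : ℝ) ^ 2 + 4 * Real.pi * N) * ∑ n ∈ Finset.Icc 1 N, a n ^ 2

/-- The amplifier identity (why the sieve bites): on an exceptional `p ≡ 5 (mod 8)` (so `p ≡ 1 (mod 4)` and reciprocity is
sign-free), every integer built from located-class primes `≤ y` has Legendre symbol `(-1)^{Ω(n)}`. -/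
def AmplifierSign (p y : ℕ) : Prop :=
  p.Prime → p % 8 = 5 → y < p → NoLocatedPrime p y →
    ∀ n : ℕ, 0 < n → (∀ q ∈ n.primeFactors, q ≤ y ∧ q % 16 = 7) →
      jacobiSym (n : ℤ) p = (-1) ^ n.primeFactorsList.length

/-- Bookkeeping (proved): outside the exceptional set the rung has a located prime `ℓ ≤ y`. -/
theorem located_of_not_mem {Q y p : ℕ} (hp : p.Prime) (hp8 : p % 8 = 5) (hyp : y < p) (hpQ : p ≤ Q)
    (h : p ∉ exceptionalSet Q y) : ∃ ℓ : ℕ, ℓ.Prime ∧ ℓ % 16 = 7 ∧ ℓ ≤ y ∧ jacobiSym (p : ℤ) ℓ = 1 := by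
  by_contra hne
  apply h
  simp only [exceptionalSet, Finset.mem_filter, Finset.mem_range]
  refine ⟨by omega, hp, hp8, hyp, ?_⟩
  intro ℓ hℓ h16 hle hJ
  exact hne ⟨ℓ, hℓ, h16, hle, hJ⟩

/-- Shape of the corner consequence this card claims (RUNG-LEVEL, not the crux): census ⇒ all but `C log⁴ Q` primes
`p ≡ 5 (mod 8)`, `√Q < p ≤ Q`, carry a located prime `ℓ ≤ √Q < 6p`, whence the door theorem fires for `W = B_p`. -/
def CornerAlmostAll : Prop :=
  ResidualCensus →
    ∃ C : ℝ, 0 < C ∧ ∀ Q : ℕ, 3 ≤ Q →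
      (((Finset.range (Q + 1)).filter (fun p => p.Prime ∧ p % 8 = 5 ∧ Nat.sqrt Q < p ∧
          ¬ ∃ ℓ : ℕ, ℓ.Prime ∧ ℓ % 16 = 7 ∧ ℓ < 6 * p ∧ jacobiSym (p : ℤ) ℓ = 1)).card : ℝ)
        ≤ C * Real.log Q ^ 4

end Summit.BirchSwinnertonDyer.BirchSwinnertonDyer.Cruxes.HeegnerTwistCouplingInSupply.LinnikSieveResidualCensus
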